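import Literature.MathematicalPhysics.QuantumFieldTheory.Balaban1983to89.B8CubeMemberBoxRows
import Literature.MathematicalPhysics.QuantumFieldTheory.Balaban1983to89.B8Eq191FlatTowerGram
import Literature.MathematicalPhysics.QuantumFieldTheory.Balaban1983to89.B8LambdaSpaceKLevel

/-!
# `Balaban1983to89.B8Eq198CubeMemberOfReal12` — [Balaban1985RegularSpaces] (1.98) FROM (1.101) AND (1.92) on the cube member: the REAL-3 family of
# `B8Prop6CubeMemberFlatScalar.prop6_cubeMember_flat_of_real` is ALGEBRA over REAL-1 (function member) and REAL-2 (function member + Δ-entry)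
# (p. 92 «Let us recall that from Theorems 3.1, 3.2 of [4] it follows that |Rf| ≦ B′₀|f| … |Rf|₍₋₂₎ ≦ B′₀|f|₍₋₂₎ (1.98)»)

statement-level skeleton of published theorems with citation tags; proofs where landed; nothing here is a claim about the
Yang–Mills mass gap

`[Balaban1985RegularSpaces]` ("B8", CMP **99** (1985) 75–102) (1.98) p. 92, (1.91)–(1.92) p. 91, (1.101) p. 93, p. 98, (1.131) p. 99; `[Balaban1985BackgroundPropagators]`
("[4]") Theorems 3.1–3.2 pp. 397–398, (3.25) p. 394 (`R = I − G′Q′*(Q′G′²Q′*)⁻¹Q′G′`).  PDF held: `paper:balaban1985-cmp99-regular-spaces-gauge-fixing`.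

CITATION HEADER (lean-in-tree rule).  Cell `pub-ymgap` (YM Track A, HUMAN RULING D-0062), DAG node N05 = [B8], seat `pub-ymgap-dag-n05-c` (g9; (R1′) programme, file F5).
The consumer displays THREE real families on the explicit flat matrices: REAL-1 ((1.101), landed on the big-block sub-lattice by F4c–F4e), REAL-2 ((1.92) + Δ-entry, OPEN),
REAL-3 ((1.98), OPEN).  THIS FILE shows that REAL-3 is NOT an independent estimate: exactly as print argues on p. 92, it follows from REAL-1 and REAL-2 by the algebra
of the letters — `T⁻¹Qᵀ(QT⁻²Qᵀ)⁻¹QT⁻¹ = T·H′·Q·T⁻¹` (`H′ = T⁻¹(T⁻¹Qᵀ)(QT⁻²Qᵀ)⁻¹`, `TT⁻¹ = 1`), `QH′ = 1` (n05-e's `B8Eq191FlatTowerGram.isUnit_towerGram`), the row formula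
for `T` (F2's stencil, here without interior hypothesis), and the fact that a site of `□_j` has tower level `≥ j`.  After this file the p6 flat road's open real
estimates are REAL-2 alone (design: `HOME/pub-ymgap-dag-n05-c/R23-DESIGN.md`).

WHAT THIS FILE PROVES (kernel-checked; theorems only; ANY `L ≥ 1`, dimension `d + 1`, cube datum with `L ≤ ρ`, truncation `n ≤ k`, ANY nonnegative weights `w`
with normalised size `w_jη²L^{2j}L^{−(d+1)j} ≤ a_max`).
* §1 `stencil_sum_zeroExt`, ★ `K_row_sum_zeroExt` — a row of the consumer's `K` against a function vanishing off `S`, at ANY site of `S` (the Dirichlet rows need no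
  interior hypothesis; cf. F2 `K_row_sum`).
* §2 `card_filter_block_le` — a block of side `Lʲ` inside `S` has `≤ (L^{d+1})ʲ` sites (F2∕g8 chart `block_eq_image`).
* §3 ★★★ `real3_of_real1_real2` — in the consumer's VERBATIM shapes (`S`, `B`, `K`, `T = Matrix.of K`, `Q = Matrix.of …`, `wt`, `cubeFam`): the function member of
  REAL-1 (constant `B_G`) and the function + Δ members of REAL-2 (constants `B₀′_H`, `B₂′`) imply REAL-3 with `B_R = 1 + (B₂′ + a_max)·B_G`:
  `wt(j)²·|ρ′(v) − Σ_z (T⁻¹(Qᵀ((QT⁻¹T⁻¹Qᵀ)⁻¹(QT⁻¹))))(v,z)ρ′(z)| ≤ B_R·r` for `v ∈ □_j`, `j ≤ n`, sources with `wt(j)²|ρ′| ≤ r`.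

HONEST SCOPE ∕ NOT CLAIMED.  Pure algebra + bookkeeping; REAL-2 is a HYPOTHESIS here (open; [4] Thm 3.2 = [B6] Prop 2.3 for the glued operator).  The REAL-2 hypothesis is
used only through its function member and Δ-entry (the gradient member is not needed); a holder of the consumer's full REAL-2 conjunction projects.  The constant
`B_R` depends on `a_max` (= 8 for this base's `wPrinted`).  Count-neutral; N05 NOT discharged; one finite `T⁴` programme at fixed `ε`, Bałaban as printed; nothing
continuum ∕ ℝ⁴ ∕ OS ∕ mass-gap ∕ Clay.  No `sorry`, no `def`, no `instance`, no `notation`.  Unit `pub-ymgap-dag-n05-c` (g9), 2026-08-27.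

RELATED IN THE TREE, NOT DUPLICATED: `B8Prop6CubeMemberFlatScalar.prop6_cubeMember_flat_of_real` (the consumer; its REAL-3 block is reproduced verbatim as the conclusion),
`B8Eq191FlatTowerGram.isUnit_towerGram` ∕ `B8Eq191FlatDirichletForm.isUnit_flatMatrix` (n05-e, USED), `B8CubeMemberBoxRows.stencil_sum` ∕ `K_row_sum` (F2; interior version),
`B8Ineq198MultiLevelBox.ineq198R_multiLevelBox` (r05: (1.98)R on the Neumann box via (3.49) kernel bounds — a different route on a different carrier),
`B8Eq1101CubeMember{Real,RealGrad,Weights}` (REAL-1, which feeds the hypothesis `hR1`).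
-/
noncomputable section

namespace Literature.MathematicalPhysics.QuantumFieldTheory.Balaban1983to89.B8Eq198CubeMemberOfReal12

open scoped Matrix
open B7Prop1Explicit (e)
open B8Eq131Cubes (cube)
open B8Eq131CubesAdmissible (cubeFam cubeFam_false_of_le)
open B8CubeMemberZd (cubeLamS)
open B8LambdaSpaceKLevel (wt)
open B8Eq191FlatDirichletForm (isUnit_flatMatrix)
open B8Eq191FlatTowerGram (isUnit_towerGram)
open B8Eq191FlatLettersCubeMember (tower_meets_cube towers_disjoint_cube cubeFam_subset_zero)
open B8Eq191FlatDirichletCoercive (towerBlock_subset_cube block_eq_image)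
open B8Eq191FlatDirichletConjugation (cover_cubeMember)
open B8Eq191FlatDirichletDepth (mem_cube_of_le_tower not_mem_cube_of_tower_lt)
open B8CubeMemberBoxRows (stencil_sum)
open Literature.MathematicalPhysics.QuantumLattice (blockMap)

variable {d : ℕ}

/-! ## §1 A row of `K` against a function vanishing off `S` (no interior hypothesis) -/

/-- The Laplacian stencil against a function vanishing off `S`, at any site of `S`. [folklore] [cite: Balaban1985RegularSpaces, (1.91) p.91] -/
theorem stencil_sum_zeroExt (S : Finset (Fin (d + 1) → ℤ)) {x : Fin (d + 1) → ℤ} (hx : x ∈ S) (μ : Fin (d + 1)) (g : (Fin (d + 1) → ℤ) → ℝ)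
    (hg : ∀ z, z ∉ S → g z = 0) :
    ∑ z ∈ S, ((2 : ℝ) * (if z = x then (1 : ℝ) else 0) - (if z = x + e μ then (1 : ℝ) else 0) - (if z = x - e μ then (1 : ℝ) else 0)) * g z
      = 2 * g x - g (x + e μ) - g (x - e μ) := by
  classical
  have h : ∀ z ∈ S, ((2 : ℝ) * (if z = x then (1 : ℝ) else 0) - (if z = x + e μ then (1 : ℝ) else 0) - (if z = x - e μ then (1 : ℝ) else 0)) * g z
      = (if z = x then 2 * g z else 0) - (if z = x + e μ then g z else 0) - (if z = x - e μ then g z else 0) := by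
    intro z _
    split_ifs <;> ring
  have hind : ∀ y, ∑ z ∈ S, (if z = y then g z else 0) = g y := by
    intro y
    rw [Finset.sum_ite_eq' S y]
    split_ifs with hy
    · rfl
    · exact (hg y hy).symm
  have hind2 : ∑ z ∈ S, (if z = x then 2 * g z else 0) = 2 * g x := by
    rw [Finset.sum_ite_eq' S x, if_pos hx]
  rw [Finset.sum_congr rfl h, Finset.sum_sub_distrib, Finset.sum_sub_distrib, hind2, hind, hind]

open Classical in
/-- **A ROW OF `K` AGAINST A FUNCTION VANISHING OFF `S`** (the consumer's convention `φ = 0` off `□₀`): for `x ∈ S`,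
`Σ_{z∈S}K(x,z)g(z) = η⁻²Σ_μ(2g(x) − g(x+e_μ) − g(x−e_μ)) + Σ_j[Bʲ(x)∈Λs j]·w_jL^{−2(d+1)j}·Σ_{z∈S,Bʲ(z)=Bʲ(x)}g(z)` — the Dirichlet rows need no interior hypothesis.
[cite: Balaban1985RegularSpaces, (1.91) p.91; Balaban1984PropagatorsII, (2.13)–(2.14) p.225] -/
theorem K_row_sum_zeroExt {η : ℝ} (L m : ℕ) (Λs : ℕ → Set (Fin (d + 1) → ℤ)) (w : ℕ → ℝ)
    (K : (Fin (d + 1) → ℤ) → (Fin (d + 1) → ℤ) → ℝ)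
    (hK : ∀ x z, K x z = ((η ^ 2)⁻¹ * ∑ μ : Fin (d + 1), ((2 : ℝ) * (if z = x then (1 : ℝ) else 0) - (if z = x + e μ then (1 : ℝ) else 0)
        - (if z = x - e μ then (1 : ℝ) else 0))) +
        (∑ j ∈ Finset.range (m + 1), (if blockMap (L ^ j) x ∈ Λs j ∧ blockMap (L ^ j) z = blockMap (L ^ j) x then
          w j * ((((L : ℝ) ^ (d + 1))⁻¹) ^ j) ^ 2 else 0)))
    (S : Finset (Fin (d + 1) → ℤ)) {x : Fin (d + 1) → ℤ} (hx : x ∈ S) (g : (Fin (d + 1) → ℤ) → ℝ) (hg : ∀ z, z ∉ S → g z = 0) :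
    ∑ z ∈ S, K x z * g z
      = (η ^ 2)⁻¹ * ∑ μ : Fin (d + 1), (2 * g x - g (x + e μ) - g (x - e μ))
        + ∑ j ∈ Finset.range (m + 1), (if blockMap (L ^ j) x ∈ Λs j then
            w j * ((((L : ℝ) ^ (d + 1))⁻¹) ^ j) ^ 2 * ∑ z ∈ S.filter (fun z => blockMap (L ^ j) z = blockMap (L ^ j) x), g z else 0) := by
  have hsplit : ∀ z ∈ S, K x z * g z
      = (η ^ 2)⁻¹ * (∑ μ : Fin (d + 1), ((2 : ℝ) * (if z = x then (1 : ℝ) else 0) - (if z = x + e μ then (1 : ℝ) else 0)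
          - (if z = x - e μ then (1 : ℝ) else 0)) * g z)
        + ∑ j ∈ Finset.range (m + 1), (if blockMap (L ^ j) x ∈ Λs j ∧ blockMap (L ^ j) z = blockMap (L ^ j) x then
          w j * ((((L : ℝ) ^ (d + 1))⁻¹) ^ j) ^ 2 else 0) * g z := by
    intro z _
    rw [hK, add_mul, mul_assoc, Finset.sum_mul, Finset.sum_mul]
  rw [Finset.sum_congr rfl hsplit, Finset.sum_add_distrib]
  congr 1
  · rw [← Finset.mul_sum, Finset.sum_comm]
    congr 1
    exact Finset.sum_congr rfl fun μ _ => stencil_sum_zeroExt S hx μ g hg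
  · rw [Finset.sum_comm]
    refine Finset.sum_congr rfl fun j _ => ?_
    by_cases hj : blockMap (L ^ j) x ∈ Λs j
    · rw [if_pos hj, Finset.mul_sum, Finset.sum_filter]
      refine Finset.sum_congr rfl fun z _ => ?_
      by_cases hz : blockMap (L ^ j) z = blockMap (L ^ j) x
      · rw [if_pos ⟨hj, hz⟩, if_pos hz]
      · rw [if_neg (fun h => hz h.2), if_neg hz, zero_mul]
    · rw [if_neg hj]
      exact Finset.sum_eq_zero fun z _ => by rw [if_neg (fun h => hj h.1), zero_mul]

/-! ## §2 Blocks: sizes and tower averages -/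

/-- A block of side `L^j` lying in `S` has at most `(L^{d+1})^j` sites. [folklore] [cite: Balaban1985RegularSpaces, p.79] -/
theorem card_filter_block_le {L : ℕ} (hL : 1 ≤ L) (j : ℕ) (S : Finset (Fin (d + 1) → ℤ)) (x : Fin (d + 1) → ℤ)
    (hfull : ∀ z, blockMap (L ^ j) z = blockMap (L ^ j) x → z ∈ S) :
    ((S.filter (fun z => blockMap (L ^ j) z = blockMap (L ^ j) x)).card : ℝ) ≤ ((L : ℝ) ^ (d + 1)) ^ j := by
  classical
  obtain ⟨n, hn⟩ : ∃ n, L ^ j = n + 1 := ⟨L ^ j - 1, (Nat.sub_add_cancel (Nat.one_le_pow _ _ hL)).symm⟩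
  have hB : ∀ z, z ∈ S.filter (fun z => blockMap (L ^ j) z = blockMap (L ^ j) x) ↔ blockMap (n + 1) z = blockMap (n + 1) x := by
    intro z
    rw [Finset.mem_filter, hn]
    exact ⟨fun h => h.2, fun h => ⟨hfull z (by rw [hn]; exact h), h⟩⟩
  rw [block_eq_image n (blockMap (n + 1) x) _ hB]
  have hc : (Finset.univ.image (fun t : Fin (d + 1) → Fin (n + 1) =>
      Literature.MathematicalPhysics.QuantumLattice.blockBase (n + 1) (blockMap (n + 1) x) + fun i => ((t i : ℕ) : ℤ))).card ≤ (n + 1) ^ (d + 1) := by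
    refine (Finset.card_image_le).trans ?_
    rw [Finset.card_univ, Fintype.card_pi, Finset.prod_const, Fintype.card_fin, Finset.card_univ, Fintype.card_fin]
  have : ((n + 1 : ℕ) : ℝ) ^ (d + 1) = ((L : ℝ) ^ (d + 1)) ^ j := by
    rw [← pow_mul, mul_comm, pow_mul]
    have : ((n + 1 : ℕ) : ℝ) = (L : ℝ) ^ j := by rw [← hn]; push_cast; ring
    rw [this]
  rw [← this]
  exact_mod_cast hc

/-! ## §3 REAL-3 from REAL-1 and REAL-2 -/

open Classical in
/-- **(1.98) FROM (1.101) AND (1.92) ON THE CUBE MEMBER — THE CONSUMER'S REAL-3 FAMILY IS ALGEBRA OVER REAL-1 AND REAL-2** (B8 p. 92 «Let us recall that from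
Theorems 3.1, 3.2 of [4] it follows that |Rf| ≦ B′₀|f|»).  Data: the explicit matrices `T = (K(x,z))`, `Q` of `B8Prop6CubeMemberFlatScalar.prop6_cubeMember_flat_of_real` at
truncation `n` (any `L ≥ 1`, any nonnegative weights with normalised size `w_jη²L^{2j}L^{−(d+1)j} ≤ a_max`).  Hypotheses: the FUNCTION member of REAL-1 (constant `B_G`)
and the FUNCTION + Δ members of REAL-2 (constants `B₀′_H`, `B₂′`), in the consumer's verbatim shapes.  Conclusion: REAL-3 verbatim with `B_R = 1 + (B₂′ + a_max)B_G`: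
`wt(j)²|ρ′(v) − (T⁻¹Qᵀ(QT⁻²Qᵀ)⁻¹QT⁻¹ρ′)(v)| ≤ B_R r` on `□_j`.  MECHANISM: `T⁻¹Qᵀ(QT⁻²Qᵀ)⁻¹QT⁻¹ρ′ = T·λ` with `λ = H′X`, `H′ = T⁻¹(T⁻¹Qᵀ)(QT⁻²Qᵀ)⁻¹`, `X = Q·T⁻¹ρ′`
(`TT⁻¹ = 1`); `|X| ≤ B_G r` (block averages of `T⁻¹ρ′`, REAL-1); the row formula gives `(Tλ)(v) = η⁻²(−Δλ)(v) + w_J L^{−2(d+1)J}·L^{(d+1)J}(Qλ)_{p(v)}` at the tower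
level `J ≥ j` of `v`, with `Qλ = QH′X = X` (`QH′ = 1`, n05-e's `isUnit_towerGram`) and the Δ-entry of REAL-2.
[cite: Balaban1985RegularSpaces, (1.98) p.92, (1.92) p.91, (1.101) p.93, (1.131) p.99; Balaban1985BackgroundPropagators, Theorems 3.1–3.2 pp.397–398, (3.25) p.394] -/
theorem real3_of_real1_real2 {L : ℕ} (hL : 1 ≤ L) (a : Fin (d + 1) → ℤ) (M : ℕ) {ρ : ℕ} (hρ : L ≤ ρ) {k n : ℕ} (hn : n ≤ k)
    {η : ℝ} (hη : η ≠ 0) (w : ℕ → ℝ) (hw0 : ∀ j, 0 ≤ w j) {amax : ℝ} (hamax0 : 0 ≤ amax)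
    (hamax : ∀ j, j ≤ n → w j * η ^ 2 * ((L : ℝ) ^ j) ^ 2 * ((((L : ℝ) ^ (d + 1)) ^ j))⁻¹ ≤ amax)
    (S : Finset (Fin (d + 1) → ℤ)) (hS : ∀ x, x ∈ S ↔ x ∈ cubeFam false L a M ρ k 0)
    (B : Finset (ℕ × (Fin (d + 1) → ℤ))) (hB : ∀ p, p ∈ B ↔ p.1 ≤ n ∧ p.2 ∈ cubeLamS L a M ρ k n p.1)
    (K : (Fin (d + 1) → ℤ) → (Fin (d + 1) → ℤ) → ℝ)
    (hK : ∀ x z, K x z = ((η ^ 2)⁻¹ * ∑ μ : Fin (d + 1), ((2 : ℝ) * (if z = x then (1 : ℝ) else 0) - (if z = x + e μ then (1 : ℝ) else 0)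
        - (if z = x - e μ then (1 : ℝ) else 0))) +
        (∑ j ∈ Finset.range (n + 1), (if blockMap (L ^ j) x ∈ cubeLamS L a M ρ k n j ∧ blockMap (L ^ j) z = blockMap (L ^ j) x then
          w j * ((((L : ℝ) ^ (d + 1))⁻¹) ^ j) ^ 2 else 0)))
    (T : Matrix ↥S ↥S ℝ) (hT : T = Matrix.of (fun x z : ↥S => K x.1 z.1))
    (Q : Matrix ↥B ↥S ℝ) (hQ : Q = Matrix.of (fun (p : ↥B) (z : ↥S) =>
      if blockMap (L ^ p.1.1) z.1 = p.1.2 then (((L : ℝ) ^ (d + 1))⁻¹) ^ p.1.1 else 0))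
    {BG B₀'H B₂' : ℝ} (hBG : 0 ≤ BG)
    (hR1 : ∀ (ρ' : ↥S → ℝ) (r : ℝ), 0 ≤ r →
      (∀ j, j ≤ n → ∀ z : ↥S, z.1 ∈ cubeFam false L a M ρ k j → wt L η j ^ 2 * |ρ' z| ≤ r) →
      ∀ φ : (Fin (d + 1) → ℤ) → ℝ, (∀ x, x ∉ cubeFam false L a M ρ k 0 → φ x = 0) → (∀ v : ↥S, φ v.1 = ∑ z : ↥S, T⁻¹ v z * ρ' z) →
      ∀ x, |φ x| ≤ BG * r)
    (hR2 : ∀ (X : ↥B → ℝ) (s : ℝ), 0 ≤ s → (∀ p', |X p'| ≤ s) →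
      ∀ φ : (Fin (d + 1) → ℤ) → ℝ, (∀ x, x ∉ cubeFam false L a M ρ k 0 → φ x = 0) →
      (∀ v : ↥S, φ v.1 = ∑ p' : ↥B, (T⁻¹ * (T⁻¹ * Qᵀ) * (Q * T⁻¹ * T⁻¹ * Qᵀ)⁻¹) v p' * X p') →
      (∀ x, |φ x| ≤ B₀'H * s) ∧
      (∀ j, j ≤ n → ∀ x ∈ cubeFam false L a M ρ k j,
        wt L η j ^ 2 * |∑ μ : Fin (d + 1), (η ^ 2)⁻¹ * (2 * φ x - φ (x + e μ) - φ (x - e μ))| ≤ B₂' * s))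
    (ρ' : ↥S → ℝ) (r : ℝ) (hr : 0 ≤ r)
    (hρ' : ∀ j, j ≤ n → ∀ z : ↥S, z.1 ∈ cubeFam false L a M ρ k j → wt L η j ^ 2 * |ρ' z| ≤ r)
    (j : ℕ) (hj : j ≤ n) (v : ↥S) (hv : v.1 ∈ cubeFam false L a M ρ k j) :
    wt L η j ^ 2 * |ρ' v - ∑ z : ↥S, (T⁻¹ * (Qᵀ * ((Q * T⁻¹ * T⁻¹ * Qᵀ)⁻¹ * (Q * T⁻¹)))) v z * ρ' z| ≤ (1 + (B₂' + amax) * BG) * r := by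
  have hd : 0 < d + 1 := Nat.succ_pos d
  have hL0 : (0 : ℝ) < L := by exact_mod_cast hL
  have hL1 : (1 : ℝ) ≤ L := by exact_mod_cast hL
  -- the units `T` and `QT⁻²Qᵀ`
  have hTunit : IsUnit T := by rw [hT]; exact isUnit_flatMatrix hd hη L n (cubeLamS L a M ρ k n) w hw0 K hK S
  have hTT : T * T⁻¹ = 1 := Matrix.mul_nonsing_inv T ((Matrix.isUnit_iff_isUnit_det T).mp hTunit)
  have hmeet : ∀ p ∈ B, ∃ z ∈ S, blockMap (L ^ p.1) z = p.2 := by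
    intro p hp
    obtain ⟨hp1, hp2⟩ := (hB p).mp hp
    obtain ⟨z, hz, hzb⟩ := tower_meets_cube hL a M hρ hn p.1 hp1 p.2 hp2
    exact ⟨z, (hS z).mpr hz, hzb⟩
  have hdisjB : ∀ p ∈ B, ∀ p' ∈ B, ∀ z ∈ S, blockMap (L ^ p.1) z = p.2 → blockMap (L ^ p'.1) z = p'.2 → p = p' := by
    intro p hp p' hp' z hz h1 h2
    obtain ⟨hp1, hp2⟩ := (hB p).mp hp
    obtain ⟨hp1', hp2'⟩ := (hB p').mp hp'
    obtain ⟨hjj, hyy⟩ := towers_disjoint_cube hL a M hρ hn p.1 hp1 p'.1 hp1' p.2 hp2 p'.2 hp2' z ((hS z).mp hz) h1 h2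
    exact Prod.ext hjj hyy
  have hMunit : IsUnit (Q * T⁻¹ * T⁻¹ * Qᵀ) := by
    rw [hQ, hT]; exact isUnit_towerGram hd hη hL n (cubeLamS L a M ρ k n) w hw0 K hK S B hmeet hdisjB
  have hMM : (Q * T⁻¹ * T⁻¹ * Qᵀ) * (Q * T⁻¹ * T⁻¹ * Qᵀ)⁻¹ = 1 :=
    Matrix.mul_nonsing_inv _ ((Matrix.isUnit_iff_isUnit_det _).mp hMunit)
  -- the letters `φ₁ = T⁻¹ρ′`, `X = Q·T⁻¹ρ′`, `λ = H′X`
  set φ₁ : (Fin (d + 1) → ℤ) → ℝ := fun x => if h : x ∈ S then ∑ z : ↥S, T⁻¹ ⟨x, h⟩ z * ρ' z else 0 with hφ₁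
  have hφ₁0 : ∀ x, x ∉ cubeFam false L a M ρ k 0 → φ₁ x = 0 := fun x hx => by rw [hφ₁]; exact dif_neg (fun h => hx ((hS x).mp h))
  have hφ₁S : ∀ u : ↥S, φ₁ u.1 = ∑ z : ↥S, T⁻¹ u z * ρ' z := fun u => by rw [hφ₁]; exact dif_pos u.2
  have hφ₁b : ∀ x, |φ₁ x| ≤ BG * r := hR1 ρ' r hr hρ' φ₁ hφ₁0 hφ₁S
  have hφ₁v : ∀ u : ↥S, φ₁ u.1 = (T⁻¹ *ᵥ ρ') u := fun u => by rw [hφ₁S]; rfl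
  set X : ↥B → ℝ := Q *ᵥ (T⁻¹ *ᵥ ρ') with hX
  -- `|X| ≤ B_G r`: block averages of `φ₁`
  have hXb : ∀ p : ↥B, |X p| ≤ BG * r := by
    intro p
    obtain ⟨hp1, hp2⟩ := (hB p.1).mp p.2
    obtain ⟨z₀, hz₀S, hz₀⟩ := hmeet p.1 p.2
    have hXp : X p = (((L : ℝ) ^ (d + 1))⁻¹) ^ p.1.1 * ∑ z ∈ S.filter (fun z => blockMap (L ^ p.1.1) z = blockMap (L ^ p.1.1) z₀), φ₁ z := by
      rw [hX, Matrix.mulVec, dotProduct, Finset.sum_filter, Finset.mul_sum, ← Finset.sum_coe_sort S]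
      refine Finset.sum_congr rfl fun z _ => ?_
      rw [hQ, Matrix.of_apply, hφ₁v z, hz₀]
      split_ifs <;> ring
    have hfull : ∀ z, blockMap (L ^ p.1.1) z = blockMap (L ^ p.1.1) z₀ → z ∈ S := by
      intro z hz
      exact (hS z).mpr (towerBlock_subset_cube hL a M hρ hn hp1 (by rw [hz₀]; exact hp2) hz)
    have hcard := card_filter_block_le hL p.1.1 S z₀ hfull
    have hsum : |∑ z ∈ S.filter (fun z => blockMap (L ^ p.1.1) z = blockMap (L ^ p.1.1) z₀), φ₁ z| ≤ ((L : ℝ) ^ (d + 1)) ^ p.1.1 * (BG * r) := by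
      refine (Finset.abs_sum_le_sum_abs _ _).trans ?_
      refine (Finset.sum_le_sum fun z _ => hφ₁b z).trans ?_
      rw [Finset.sum_const, nsmul_eq_mul]
      exact mul_le_mul_of_nonneg_right hcard (by positivity)
    rw [hXp, abs_mul, abs_of_nonneg (by positivity)]
    have hpow : 0 < ((L : ℝ) ^ (d + 1)) ^ p.1.1 := by positivity
    calc (((L : ℝ) ^ (d + 1))⁻¹) ^ p.1.1 * |∑ z ∈ S.filter (fun z => blockMap (L ^ p.1.1) z = blockMap (L ^ p.1.1) z₀), φ₁ z|
        ≤ (((L : ℝ) ^ (d + 1))⁻¹) ^ p.1.1 * (((L : ℝ) ^ (d + 1)) ^ p.1.1 * (BG * r)) := mul_le_mul_of_nonneg_left hsum (by positivity)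
      _ = BG * r := by rw [inv_pow]; field_simp
  -- `λ = H′X` and its zero extension; the REAL-2 bounds at `s = B_G r`
  set lam : ↥S → ℝ := (T⁻¹ * (T⁻¹ * Qᵀ) * (Q * T⁻¹ * T⁻¹ * Qᵀ)⁻¹) *ᵥ X with hlam
  obtain ⟨lamf, hlamfS0, hlamfS'⟩ : ∃ f : (Fin (d + 1) → ℤ) → ℝ, (∀ u : ↥S, f u.1 = lam u) ∧ (∀ x, x ∉ S → f x = 0) :=
    ⟨fun x => if h : x ∈ S then lam ⟨x, h⟩ else 0, fun u => by simp [u.2], fun x hx => by simp [hx]⟩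
  have hlamf0 : ∀ x, x ∉ cubeFam false L a M ρ k 0 → lamf x = 0 := fun x hx => hlamfS' x (fun h => hx ((hS x).mp h))
  have hlamfS : ∀ u : ↥S, lamf u.1 = ∑ p' : ↥B, (T⁻¹ * (T⁻¹ * Qᵀ) * (Q * T⁻¹ * T⁻¹ * Qᵀ)⁻¹) u p' * X p' := by
    intro u; rw [hlamfS0]; rfl
  obtain ⟨-, hΔ⟩ := hR2 X (BG * r) (by positivity) hXb lamf hlamf0 hlamfS
  -- the operator of REAL-3 applied to `ρ′` is `T·λ`
  have hop : ∀ u : ↥S, ∑ z : ↥S, (T⁻¹ * (Qᵀ * ((Q * T⁻¹ * T⁻¹ * Qᵀ)⁻¹ * (Q * T⁻¹)))) u z * ρ' z = (T *ᵥ lam) u := by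
    intro u
    have hmat : T * (T⁻¹ * (T⁻¹ * Qᵀ) * (Q * T⁻¹ * T⁻¹ * Qᵀ)⁻¹) * Q * T⁻¹ = T⁻¹ * (Qᵀ * ((Q * T⁻¹ * T⁻¹ * Qᵀ)⁻¹ * (Q * T⁻¹))) := by
      simp only [← Matrix.mul_assoc]
      rw [hTT, Matrix.one_mul]
    rw [hlam, hX, Matrix.mulVec_mulVec, Matrix.mulVec_mulVec, Matrix.mulVec_mulVec, hmat]
    rfl
  -- `Qλ = X` (`QH′ = 1`)
  have hQlam : Q *ᵥ lam = X := by
    rw [hlam, Matrix.mulVec_mulVec]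
    have : Q * (T⁻¹ * (T⁻¹ * Qᵀ) * (Q * T⁻¹ * T⁻¹ * Qᵀ)⁻¹) = 1 := by
      rw [show Q * (T⁻¹ * (T⁻¹ * Qᵀ) * (Q * T⁻¹ * T⁻¹ * Qᵀ)⁻¹) = (Q * T⁻¹ * T⁻¹ * Qᵀ) * (Q * T⁻¹ * T⁻¹ * Qᵀ)⁻¹ by
        simp only [← Matrix.mul_assoc], hMM]
    rw [this, Matrix.one_mulVec]
  -- the row of `T` at `v` against `λ`
  have hrow : (T *ᵥ lam) v = ∑ z ∈ S, K v.1 z * lamf z := by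
    rw [Matrix.mulVec, dotProduct, ← Finset.sum_coe_sort S]
    refine Finset.sum_congr rfl fun z _ => ?_
    rw [hT, Matrix.of_apply, hlamfS0 z]
  have hKrow := K_row_sum_zeroExt L n (cubeLamS L a M ρ k n) w K hK S v.2 lamf hlamfS'
  -- the tower level `J` of `v`, and `j ≤ J`
  have hv0 : v.1 ∈ cubeFam false L a M ρ k 0 := (hS v.1).mp v.2
  obtain ⟨J, hJn, hvJ⟩ := cover_cubeMember hL a M hρ hn v.1 hv0
  have hjJ : j ≤ J := by
    by_contra hc; push Not at hc
    rcases Nat.lt_or_ge J n with hJlt | hJge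
    · have hvj : v.1 ∈ cube L a M ρ k j := by rw [← cubeFam_false_of_le L a M ρ (hj.trans hn)]; exact hv
      exact not_mem_cube_of_tower_lt hL a M hρ hn hJlt hc (hj.trans hn) hvJ hvj
    · omega
  -- collapse of the level sum to `J`
  have hcollapse : ∑ j' ∈ Finset.range (n + 1), (if blockMap (L ^ j') v.1 ∈ cubeLamS L a M ρ k n j' then
        w j' * ((((L : ℝ) ^ (d + 1))⁻¹) ^ j') ^ 2 * ∑ z ∈ S.filter (fun z => blockMap (L ^ j') z = blockMap (L ^ j') v.1), lamf z else 0)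
      = w J * ((((L : ℝ) ^ (d + 1))⁻¹) ^ J) ^ 2 * ∑ z ∈ S.filter (fun z => blockMap (L ^ J) z = blockMap (L ^ J) v.1), lamf z := by
    have h : ∀ j' ∈ Finset.range (n + 1), (if blockMap (L ^ j') v.1 ∈ cubeLamS L a M ρ k n j' then
        w j' * ((((L : ℝ) ^ (d + 1))⁻¹) ^ j') ^ 2 * ∑ z ∈ S.filter (fun z => blockMap (L ^ j') z = blockMap (L ^ j') v.1), lamf z else 0)
        = if J = j' then w J * ((((L : ℝ) ^ (d + 1))⁻¹) ^ J) ^ 2 * ∑ z ∈ S.filter (fun z => blockMap (L ^ J) z = blockMap (L ^ J) v.1), lamf z else 0 := by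
      intro j' hj'
      have hj'n : j' ≤ n := Nat.lt_succ_iff.mp (Finset.mem_range.mp hj')
      by_cases hc : blockMap (L ^ j') v.1 ∈ cubeLamS L a M ρ k n j'
      · have hjj : j' = J := (towers_disjoint_cube hL a M hρ hn j' hj'n J hJn _ hc _ hvJ v.1 hv0 rfl rfl).1
        subst hjj; rw [if_pos hc, if_pos rfl]
      · have hne : J ≠ j' := fun h => by subst h; exact hc hvJ
        rw [if_neg hc, if_neg hne]
    rw [Finset.sum_congr rfl h, Finset.sum_ite_eq, if_pos (Finset.mem_range.mpr (Nat.lt_succ_of_le hJn))]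
  -- the block sum is `L^{(d+1)J}·X_{p(v)}`
  have hpB : (J, blockMap (L ^ J) v.1) ∈ B := (hB _).mpr ⟨hJn, hvJ⟩
  have hblock : ∑ z ∈ S.filter (fun z => blockMap (L ^ J) z = blockMap (L ^ J) v.1), lamf z
      = ((L : ℝ) ^ (d + 1)) ^ J * X ⟨(J, blockMap (L ^ J) v.1), hpB⟩ := by
    have hQl : (Q *ᵥ lam) ⟨(J, blockMap (L ^ J) v.1), hpB⟩
        = (((L : ℝ) ^ (d + 1))⁻¹) ^ J * ∑ z ∈ S.filter (fun z => blockMap (L ^ J) z = blockMap (L ^ J) v.1), lamf z := by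
      rw [Matrix.mulVec, dotProduct, Finset.sum_filter, Finset.mul_sum, ← Finset.sum_coe_sort S]
      refine Finset.sum_congr rfl fun z _ => ?_
      rw [hQ, Matrix.of_apply, hlamfS0 z]
      dsimp only
      split_ifs <;> ring
    rw [hQlam] at hQl
    rw [hQl, inv_pow, ← mul_assoc, mul_inv_cancel₀ (by positivity), one_mul]
  -- the weight factor: `(Lʲη)²·w_J·L^{−(d+1)J} ≤ a_max` since `j ≤ J`
  have hwt : wt L η j ^ 2 * (w J * ((((L : ℝ) ^ (d + 1))⁻¹) ^ J) ^ 2 * ((L : ℝ) ^ (d + 1)) ^ J) ≤ amax := by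
    have hJ := hamax J hJn
    have hid : wt L η j ^ 2 * (w J * ((((L : ℝ) ^ (d + 1))⁻¹) ^ J) ^ 2 * ((L : ℝ) ^ (d + 1)) ^ J)
        = (w J * η ^ 2 * ((L : ℝ) ^ J) ^ 2 * ((((L : ℝ) ^ (d + 1)) ^ J))⁻¹) * (((L : ℝ) ^ j) ^ 2 / ((L : ℝ) ^ J) ^ 2) := by
      unfold wt; rw [inv_pow]; field_simp
    rw [hid]
    have hratio : ((L : ℝ) ^ j) ^ 2 / ((L : ℝ) ^ J) ^ 2 ≤ 1 := by
      rw [div_le_one (by positivity)]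
      exact pow_le_pow_left₀ (by positivity) (pow_le_pow_right₀ hL1 hjJ) 2
    have hnn : 0 ≤ w J * η ^ 2 * ((L : ℝ) ^ J) ^ 2 * ((((L : ℝ) ^ (d + 1)) ^ J))⁻¹ := by
      have := hw0 J; positivity
    calc (w J * η ^ 2 * ((L : ℝ) ^ J) ^ 2 * ((((L : ℝ) ^ (d + 1)) ^ J))⁻¹) * (((L : ℝ) ^ j) ^ 2 / ((L : ℝ) ^ J) ^ 2)
        ≤ amax * 1 := mul_le_mul hJ hratio (by positivity) hamax0
      _ = amax := mul_one _
  -- assemble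
  have hΔv := hΔ j hj v.1 hv
  have hLap : wt L η j ^ 2 * |(η ^ 2)⁻¹ * ∑ μ : Fin (d + 1), (2 * lamf v.1 - lamf (v.1 + e μ) - lamf (v.1 - e μ))| ≤ B₂' * (BG * r) := by
    rw [Finset.mul_sum]; exact hΔv
  have hρv : wt L η j ^ 2 * |ρ' v| ≤ r := hρ' j hj v hv
  have hwt0 : 0 ≤ wt L η j ^ 2 := sq_nonneg _
  rw [hop v, hrow, hKrow, hcollapse, hblock]
  have hblk : wt L η j ^ 2 * |w J * ((((L : ℝ) ^ (d + 1))⁻¹) ^ J) ^ 2 * (((L : ℝ) ^ (d + 1)) ^ J * X ⟨(J, blockMap (L ^ J) v.1), hpB⟩)|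
      ≤ amax * (BG * r) := by
    rw [show w J * ((((L : ℝ) ^ (d + 1))⁻¹) ^ J) ^ 2 * (((L : ℝ) ^ (d + 1)) ^ J * X ⟨(J, blockMap (L ^ J) v.1), hpB⟩)
        = (w J * ((((L : ℝ) ^ (d + 1))⁻¹) ^ J) ^ 2 * ((L : ℝ) ^ (d + 1)) ^ J) * X ⟨(J, blockMap (L ^ J) v.1), hpB⟩ by ring,
      abs_mul, abs_of_nonneg (by have := hw0 J; positivity), ← mul_assoc]
    exact mul_le_mul hwt (hXb _) (abs_nonneg _) hamax0
  calc wt L η j ^ 2 * |ρ' v - ((η ^ 2)⁻¹ * ∑ μ : Fin (d + 1), (2 * lamf v.1 - lamf (v.1 + e μ) - lamf (v.1 - e μ))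
        + w J * ((((L : ℝ) ^ (d + 1))⁻¹) ^ J) ^ 2 * (((L : ℝ) ^ (d + 1)) ^ J * X ⟨(J, blockMap (L ^ J) v.1), hpB⟩))|
      ≤ wt L η j ^ 2 * (|ρ' v| + (|(η ^ 2)⁻¹ * ∑ μ : Fin (d + 1), (2 * lamf v.1 - lamf (v.1 + e μ) - lamf (v.1 - e μ))|
        + |w J * ((((L : ℝ) ^ (d + 1))⁻¹) ^ J) ^ 2 * (((L : ℝ) ^ (d + 1)) ^ J * X ⟨(J, blockMap (L ^ J) v.1), hpB⟩)|)) := by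
        refine mul_le_mul_of_nonneg_left ?_ hwt0
        exact (abs_sub _ _).trans (add_le_add le_rfl (abs_add_le _ _))
    _ ≤ r + (B₂' * (BG * r) + amax * (BG * r)) := by
        rw [mul_add, mul_add]; exact add_le_add hρv (add_le_add hLap hblk)
    _ = (1 + (B₂' + amax) * BG) * r := by ring

end Literature.MathematicalPhysics.QuantumFieldTheory.Balaban1983to89.B8Eq198CubeMemberOfReal12
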